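import Literature.AlgebraicGeometry.Frobenioids.Cor411Padic
import Literature.AlgebraicGeometry.Frobenioids.PadicFrobenioidRelCosetBase
import HarnessLib

/-!
# Frobenioids I, Corollary 4.11 (ii)–(iv) at the `p`-adic Frobenioids over the tempered bases
# `D = 𝓑^temp(Π, Π°)⁰` of [FrdII] Example 1.3 — for `Π` with slim `𝓑^temp(Π)⁰` (e.g. `Π` slim profinite)

Mochizuki, *The geometry of Frobenioids I*, Kyushu J. Math. **62** (2008), Cor. 4.11 pp. 91–92
[cite: MochizukiFrdI2008, Cor. 4.11 p.91]; *The geometry of Frobenioids II*, Kyushu J. Math. **62** (2008),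
Example 1.3 (iii) pp. 11–12, Theorem 1.2 (iv) p. 9 ("If `D` is slim … then `C` is also slim")
[cite: MochizukiFrdII2008, Ex 1.3 (iii) pp.11-12].

PROOF-ONLY file (node FrdI:Cor4.11 / FrdII:Ex1.3(iii); seat abc-iut-w4-d109; sequel of `Cor411Padic.lean` and
`Thm49PadicTempered.lean`), 0 definitions. `Cor411Padic.lean` gives Cor. 4.11 at `p`-adic Frobenioids over SLIM
bases of FSM-type. The small model `RelCosetCat Π°` of `𝓑^temp(Π, Π°)⁰` is of FSM-type (seat abc-iut-L1-t4's
`RelCosetCat.isOfFSMType`) and inherits slimness from `CosetCat Π = 𝓑^temp(Π)⁰` (`RelCosetCat.isSlim_of_isSlim`),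
which is slim for a slim profinite `Π` (seat abc-iut-L1-t4's `isSlim_cosetCat_of_isSlimGroup`). Hence, for
`p`-adic Frobenioid data `d_i : PadicFrd.Datum (RelCosetCat Π°_i) p_i`: the typed Cor. 4.11 (ii)/(iii)/(iv) with no
hypothesis (`cor411ii/iii/iv_padic_relCoset`), and — given `IsSlim (CosetCat Π_i)`, resp. `Π_i` slim profinite —
`Ψ^Base` with its `1`-unique square, the divisor transport `Ψ^Φ` over `Ψ^Base`, and the Cor. 4.11 (iv) data, for
every `Ψ : C₁ ⥲ C₂` (`exists_divisorTransport_padic_relCoset(_of_isSlimGroup)` etc.). No statement of either paper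
is restated or strengthened; nothing here bears on, or takes a side on, [IUTchIII] Cor. 3.12.
-/

noncomputable section

namespace Literature.AlgebraicGeometry.Frobenioids

open CategoryTheory Opposite
open PreFrobenioid PreFrobenioidData Literature.AnabelianGeometry.SemiGraphs

namespace PadicFrd

section Tempered

variable {P₁ : Type} [Group P₁] [TopologicalSpace P₁] [IsTopologicalGroup P₁] (P₀₁ : OpenSubgroup P₁)
variable {P₂ : Type} [Group P₂] [TopologicalSpace P₂] [IsTopologicalGroup P₂] (P₀₂ : OpenSubgroup P₂)
variable {p₁ p₂ : ℕ} [Fact p₁.Prime] [Fact p₂.Prime]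
variable (d₁ : Datum (RelCosetCat P₀₁) p₁) (d₂ : Datum (RelCosetCat P₀₂) p₂)

/-- **[FrdI] Cor. 4.11 (ii) AS TYPED for `p`-adic Frobenioids over tempered bases, no hypothesis.**
[cite: MochizukiFrdI2008, Cor. 4.11 (ii) p.91] [cite: MochizukiFrdII2008, Ex 1.3 (iii) pp.11-12] -/
theorem cor411ii_padic_relCoset (Ψ : d₁.frobenioid ≌ d₂.frobenioid) :
    (ModelFrobenioid.data d₁.Φ d₁.B d₁.divB).Cor411ii (ModelFrobenioid.data d₂.Φ d₂.B d₂.divB) Ψ :=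
  cor411ii_padic d₁ d₂ (RelCosetCat.isOfFSMType P₀₁) (RelCosetCat.isOfFSMType P₀₂) Ψ

/-- **[FrdI] Cor. 4.11 (iii) AS TYPED for `p`-adic Frobenioids over tempered bases, any parameters, no hypothesis.**
[cite: MochizukiFrdI2008, Cor. 4.11 (iii) p.92] [cite: MochizukiFrdII2008, Ex 1.3 (iii) pp.11-12] -/
theorem cor411iii_padic_relCoset (Ψ : d₁.frobenioid ≌ d₂.frobenioid)
    (R₁ : (ModelFrobenioid.data d₁.Φ d₁.B d₁.divB).RSParams)
    (R₂ : (ModelFrobenioid.data d₂.Φ d₂.B d₂.divB).RSParams) :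
    (ModelFrobenioid.data d₁.Φ d₁.B d₁.divB).Cor411iii (ModelFrobenioid.data d₂.Φ d₂.B d₂.divB) Ψ R₁ R₂ :=
  cor411iii_padic d₁ d₂ (RelCosetCat.isOfFSMType P₀₁) (RelCosetCat.isOfFSMType P₀₂) Ψ R₁ R₂

/-- **[FrdI] Cor. 4.11 (iv) AS TYPED for `p`-adic Frobenioids over tempered bases, any parameters, no hypothesis.**
[cite: MochizukiFrdI2008, Cor. 4.11 (iv) p.92] [cite: MochizukiFrdII2008, Ex 1.3 (iii) pp.11-12] -/
theorem cor411iv_padic_relCoset (Ψ : d₁.frobenioid ≌ d₂.frobenioid)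
    (R₁ : (ModelFrobenioid.data d₁.Φ d₁.B d₁.divB).RSParams)
    (R₂ : (ModelFrobenioid.data d₂.Φ d₂.B d₂.divB).RSParams) :
    (ModelFrobenioid.data d₁.Φ d₁.B d₁.divB).Cor411iv (ModelFrobenioid.data d₂.Φ d₂.B d₂.divB) Ψ R₁ R₂ :=
  cor411iv_padic d₁ d₂ (RelCosetCat.isOfFSMType P₀₁) (RelCosetCat.isOfFSMType P₀₂) Ψ R₁ R₂

/-- **The Cor. 4.11 hypothesis package HOLDS over tempered bases with slim `𝓑^temp(Π_i)⁰`** (Div-slim from slim;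
[FrdII] Thm. 1.2 (i)). [cite: MochizukiFrdI2008, Cor. 4.11 p.91] [cite: MochizukiFrdII2008, Ex 1.3 (iii) pp.11-12] -/
theorem cor411Setting_padic_relCoset (hsl₁ : IsSlim (CosetCat P₁)) (hsl₂ : IsSlim (CosetCat P₂))
    (Ψ : d₁.frobenioid ≌ d₂.frobenioid) :
    (ModelFrobenioid.data d₁.Φ d₁.B d₁.divB).Cor411Setting (ModelFrobenioid.data d₂.Φ d₂.B d₂.divB) Ψ :=
  cor411Setting_padic d₁ d₂ (RelCosetCat.isOfFSMType P₀₁) (RelCosetCat.isOfFSMType P₀₂)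
    (RelCosetCat.isSlim_of_isSlim P₀₁ hsl₁) (RelCosetCat.isSlim_of_isSlim P₀₂ hsl₂) Ψ

/-- **The conclusion of [FrdI] Cor. 4.11 (iii) for `p`-adic Frobenioids over tempered bases with slim
`𝓑^temp(Π_i)⁰`**: every `Ψ : C₁ ⥲ C₂` induces a `1`-unique `Ψ^Base : D₁ ⥲ D₂` and an isomorphism of functors
`Ψ^Φ : Φ₁ ⥲ Φ₂` lying over `Ψ^Base`. [cite: MochizukiFrdI2008, Cor. 4.11 (iii) p.92]
[cite: MochizukiFrdII2008, Ex 1.3 (iii) pp.11-12] -/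
theorem exists_divisorTransport_padic_relCoset (hsl₁ : IsSlim (CosetCat P₁)) (hsl₂ : IsSlim (CosetCat P₂))
    (Ψ : d₁.frobenioid ≌ d₂.frobenioid) :
    ∃ ΨBase : RelCosetCat P₀₁ ⥤ RelCosetCat P₀₂,
      OneUniqueSquare Ψ.functor (ModelFrobenioid.data d₁.Φ d₁.B d₁.divB).base
          (ModelFrobenioid.data d₂.Φ d₂.B d₂.divB).base ΨBase ∧
        Nonempty (DivisorMonoidIsoOverBase (ModelFrobenioid.data d₁.Φ d₁.B d₁.divB)
          (ModelFrobenioid.data d₂.Φ d₂.B d₂.divB) ΨBase) :=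
  exists_divisorTransport_padic d₁ d₂ (RelCosetCat.isOfFSMType P₀₁) (RelCosetCat.isOfFSMType P₀₂)
    (RelCosetCat.isSlim_of_isSlim P₀₁ hsl₁) (RelCosetCat.isSlim_of_isSlim P₀₂ hsl₂) Ψ

/-- **The conclusion of [FrdI] Cor. 4.11 (iv) for `p`-adic Frobenioids over tempered bases with slim
`𝓑^temp(Π_i)⁰`**: the `1`-commutative diagram `(Base, Div, deg_Fr)` — `Ψ^Base` an equivalence, `Ψ^Φ`, `η`,
Frobenius degrees preserved, `Div(Ψ φ) = η_A^* Ψ^Φ(Div φ)`, rigid base composites.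
[cite: MochizukiFrdI2008, Cor. 4.11 (iv) p.92] [cite: MochizukiFrdII2008, Ex 1.3 (iii) pp.11-12] -/
theorem exists_cor411iv_data_padic_relCoset (hsl₁ : IsSlim (CosetCat P₁)) (hsl₂ : IsSlim (CosetCat P₂))
    (Ψ : d₁.frobenioid ≌ d₂.frobenioid) :
    ∃ (ΨBase : RelCosetCat P₀₁ ⥤ RelCosetCat P₀₂)
      (E : DivisorMonoidIsoOverBase (ModelFrobenioid.data d₁.Φ d₁.B d₁.divB)
        (ModelFrobenioid.data d₂.Φ d₂.B d₂.divB) ΨBase)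
      (η : Ψ.functor ⋙ (ModelFrobenioid.data d₂.Φ d₂.B d₂.divB).base ≅
        (ModelFrobenioid.data d₁.Φ d₁.B d₁.divB).base ⋙ ΨBase),
      ΨBase.IsEquivalence ∧
        PreservesDegFr (ModelFrobenioid.data d₁.Φ d₁.B d₁.divB) (ModelFrobenioid.data d₂.Φ d₂.B d₂.divB) Ψ ∧
        (∀ ⦃A B : d₁.frobenioid⦄ (φ : A ⟶ B),
          (ModelFrobenioid.data d₂.Φ d₂.B d₂.divB).div (Ψ.functor.map φ) =
            (ModelFrobenioid.data d₂.Φ d₂.B d₂.divB).pull (η.hom.app A)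
              (E.iso ((ModelFrobenioid.data d₁.Φ d₁.B d₁.divB).base.obj A)
                ((ModelFrobenioid.data d₁.Φ d₁.B d₁.divB).div φ))) ∧
        (IsRigidFunctor (Ψ.functor ⋙ (ModelFrobenioid.data d₂.Φ d₂.B d₂.divB).base) ∧
          IsRigidFunctor ((ModelFrobenioid.data d₁.Φ d₁.B d₁.divB).base ⋙ ΨBase)) :=
  exists_cor411iv_data_padic d₁ d₂ (RelCosetCat.isOfFSMType P₀₁) (RelCosetCat.isOfFSMType P₀₂)
    (RelCosetCat.isSlim_of_isSlim P₀₁ hsl₁) (RelCosetCat.isSlim_of_isSlim P₀₂ hsl₂) Ψ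

/-- **Cor. 4.11 (i) for `p`-adic Frobenioids over tempered bases with slim `𝓑^temp(Π_i)⁰`**: `Ψ^istr` and the
typed `Cor411i`. [cite: MochizukiFrdI2008, Cor. 4.11 (i) p.91] [cite: MochizukiFrdII2008, Ex 1.3 (iii) pp.11-12] -/
theorem exists_cor411i_padic_relCoset (hsl₁ : IsSlim (CosetCat P₁)) (hsl₂ : IsSlim (CosetCat P₂))
    (Ψ : d₁.frobenioid ≌ d₂.frobenioid) :
    ∃ Ψistr : (ModelFrobenioid.data d₁.Φ d₁.B d₁.divB).Istr ≌ (ModelFrobenioid.data d₂.Φ d₂.B d₂.divB).Istr,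
      Ψistr.functor ⋙ (ModelFrobenioid.data d₂.Φ d₂.B d₂.divB).istrι =
          (ModelFrobenioid.data d₁.Φ d₁.B d₁.divB).istrι ⋙ Ψ.functor ∧
        (ModelFrobenioid.data d₁.Φ d₁.B d₁.divB).Cor411i (ModelFrobenioid.data d₂.Φ d₂.B d₂.divB) Ψ
          Ψistr.functor :=
  exists_cor411i_padic d₁ d₂ (RelCosetCat.isOfFSMType P₀₁) (RelCosetCat.isOfFSMType P₀₂)
    (RelCosetCat.isSlim_of_isSlim P₀₁ hsl₁) (RelCosetCat.isSlim_of_isSlim P₀₂ hsl₂) Ψ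

end Tempered

/-! ### Slim profinite `Π`: the slimness premise discharged ([FrdII] Ex. 1.1 (i) / Thm. 1.2 (iv)) -/

section Profinite

variable {P₁ : Type} [Group P₁] [TopologicalSpace P₁] [IsTopologicalGroup P₁] [CompactSpace P₁]
  [TotallyDisconnectedSpace P₁] (P₀₁ : OpenSubgroup P₁)
variable {P₂ : Type} [Group P₂] [TopologicalSpace P₂] [IsTopologicalGroup P₂] [CompactSpace P₂]
  [TotallyDisconnectedSpace P₂] (P₀₂ : OpenSubgroup P₂)
variable {p₁ p₂ : ℕ} [Fact p₁.Prime] [Fact p₂.Prime]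
variable (d₁ : Datum (RelCosetCat P₀₁) p₁) (d₂ : Datum (RelCosetCat P₀₂) p₂)

/-- **The conclusion of [FrdI] Cor. 4.11 (iii) for `p`-adic Frobenioids over `𝓑^temp(Π_i, Π°_i)⁰` with `Π_i` SLIM
PROFINITE groups** (slimness of `𝓑(Π)⁰` from slimness of `Π`, seat abc-iut-L1-t4's `isSlim_cosetCat_of_isSlimGroup`):
for every `Ψ : C₁ ⥲ C₂`, a `1`-unique `Ψ^Base` and `Ψ^Φ : Φ₁ ⥲ Φ₂` over it.
[cite: MochizukiFrdI2008, Cor. 4.11 (iii) p.92] [cite: MochizukiFrdII2008, Thm 1.2 (iv) p.9] -/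
theorem exists_divisorTransport_padic_relCoset_of_isSlimGroup (hZ₁ : IsSlimGroup P₁) (hZ₂ : IsSlimGroup P₂)
    (Ψ : d₁.frobenioid ≌ d₂.frobenioid) :
    ∃ ΨBase : RelCosetCat P₀₁ ⥤ RelCosetCat P₀₂,
      OneUniqueSquare Ψ.functor (ModelFrobenioid.data d₁.Φ d₁.B d₁.divB).base
          (ModelFrobenioid.data d₂.Φ d₂.B d₂.divB).base ΨBase ∧
        Nonempty (DivisorMonoidIsoOverBase (ModelFrobenioid.data d₁.Φ d₁.B d₁.divB)
          (ModelFrobenioid.data d₂.Φ d₂.B d₂.divB) ΨBase) :=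
  exists_divisorTransport_padic_relCoset P₀₁ P₀₂ d₁ d₂ (isSlim_cosetCat_of_isSlimGroup hZ₁)
    (isSlim_cosetCat_of_isSlimGroup hZ₂) Ψ

end Profinite

end PadicFrd

end Literature.AlgebraicGeometry.Frobenioids

end
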